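import Literature.NumberTheory.Rogawski1990.StableConjugacyU3
import Literature.NumberTheory.Automorphic.AdelicUnitaryGroupDatum
import HarnessLib

/-!
# Corresponding elements with a SCALAR on one side are equal as matrices; class-preserving identifications `ψ_v : G′_v ≅ G_v` fix the centre,
# so matching local test functions agree at central elements: `f_v(ζ·1) = f′_v(ζ·1)`
(Rogawski, *Automorphic Representations of Unitary Groups in Three Variables* (1990), §14.1–14.2 pp. 232–233, §14.5 p. 239)

Topic `NumberTheory/Rogawski1990`; namespace `Literature.NumberTheory.Rogawski1990`.  THEOREMS ONLY (no definition, no instance, no named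
fact, no `sorry`).  Cell `pub/hodgecm-mathlib`, ENGINE T1 (crux item stmt-HodgeConjecture-24833), row N3-finite of the O7 census
(`F0/P3a/A-p01/CENSUS-O7-SingularClasses.v2.A-p01g14.md`; F0P3a-plan (g4) GO #94 (2)): the FINITE-PLACE half of the identity
«`f′_v(γ₀) = f_v(γ₀)` for `γ₀` central» that the proof of [Rogawski1990, Thm. 14.5.1 (a)] uses at the CENTRAL stable classes (p. 239: «If `γ₀` is
central in `G`, then `f′_v(γ₀) = f_v(γ₀)`»).  At the finite places (`D = M₃(E)`: `S` contains no finite place) the transfer `f′ ↦ f` is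
`f_v = f′_v ∘ ψ_v⁻¹` for an inner identification `ψ_v : G′_v ≅ G_v` (§14.2 (14.2.1); the engine line's pin (ix) `IsPinned.transfer_loc`) which is
CLASS-PRESERVING (§14.1: `γ′ ↔ ψ_v γ′`, the line's pin (x) `IsPinned.corresponds` ∕ `.corresponds_symm`, ★ `Rogawski1990.Corresponds` = conjugacy in the
ambient `GL₃`).  A conjugate of a scalar matrix is the same scalar matrix, so `ψ_v⁻¹(ζ·1_G) = ζ·1_{G′}` and `f_v(ζ·1) = f′_v(ζ·1)` — no harmonic analysis.
(The archimedean half, at `v ∈ S₀`, is a limit formula [Rogawski1990, §8.4] and is NOT claimed here.)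

* §1 (any commutative ring, any index type) `val_eq_smul_one_of_isConj` — if `g₁, g₂ ∈ GL_n(R)` are conjugate and `g₁ = z·1` then `g₂ = z·1`;
  `Corresponds.val_eq_smul_one` ∕ `Corresponds.val_eq_smul_one_left` — the same for ★ `Corresponds σ H₁ H₂ γ₁ γ₂` in either direction;
  `Corresponds.eq_of_val_eq_smul_one` — hence `γ₂` IS the scalar element of `U(H₂)` with matrix `z·1` (elements of `U(H)` are determined by their matrices).
* §2 `apply_eq_of_forall_corresponds_of_val_eq_smul_one` — a map `ψ : U(H₁) → U(H₂)` with `γ ↔ ψ γ` for all `γ` sends the scalar `z·1` of `U(H₁)` to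
  the scalar `z·1` of `U(H₂)`; `comp_apply_eq_of_forall_corresponds` — so `(f₁ ∘ ψ) (z·1) = f₁ (z·1)` read across the two groups.
* §3 THE CM ∕ LOCAL DRESS at the engine line's shapes: for `ψ : (cmDatum L N H).Local v ≃ₜ* (cmDatum L N H′).Local v` with
  `∀ γ, Corresponds (conjLocal L c v) (H_v) (H′_v) (ψ.symm γ) γ` (pin (x), `G → G′` direction) and local factors with `f = f′ ∘ ψ.symm` (pin (ix)),
  **`UnitaryGroup.loc_apply_eq_of_eq_comp_symm_of_central`**: `f γ = f′ γ′` whenever `γ ∈ U(H′)(L⁺_v)` and `γ′ ∈ U(H)(L⁺_v)` have the same scalar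
  matrix `z·1`; and the `ψ`-direction twin `UnitaryGroup.symm_apply_eq_of_central`: `ψ.symm γ = γ′`.

## References
* J. Rogawski, *Automorphic Representations of Unitary Groups in Three Variables*, Ann. of Math. Stud. 123 (1990), §14.1 p. 232 («we fix an
  inner isomorphism `ψ : G′ → G`»; `γ′ ↔ γ`), §14.2 (14.2.1) pp. 232–233, §14.5 proof of Thm. 14.5.1 (a) p. 239 [Rogawski1990].
-/

set_option autoImplicit false

noncomputable section

open scoped MatrixGroups

namespace Literature.NumberTheory.Rogawski1990

open Literature.AlgebraicGeometry.ShimuraVarieties (unitaryGroup)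

/-! ## §1 Conjugates of scalars are scalars -/

section Algebra

variable {R : Type*} [CommRing R] {n : Type*} [Fintype n] [DecidableEq n]

/-- If `g₁, g₂ ∈ GL_n(R)` are conjugate and `g₁` is the scalar matrix `z·1`, then so is `g₂` (`c (z·1) c⁻¹ = z·1`).
[cite: Rogawski1990, §14.1 p. 232] -/
theorem val_eq_smul_one_of_isConj {g₁ g₂ : GL n R} (h : IsConj g₁ g₂) {z : R} (h₁ : (g₁ : Matrix n n R) = z • (1 : Matrix n n R)) :
    (g₂ : Matrix n n R) = z • (1 : Matrix n n R) := by
  obtain ⟨c, hc⟩ := h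
  -- `hc : SemiconjBy ↑c g₁ g₂`, i.e. `c * g₁ = g₂ * c` in `GL n R`
  have hmat : ((c : GL n R) : Matrix n n R) * (g₁ : Matrix n n R) = (g₂ : Matrix n n R) * ((c : GL n R) : Matrix n n R) := by
    have := congrArg (fun u : GL n R => (u : Matrix n n R)) hc.eq
    simpa only [Units.val_mul] using this
  rw [h₁, Matrix.mul_smul, Matrix.mul_one] at hmat
  -- `z • C = g₂ * C`; multiply by `C⁻¹` on the right
  have hC : ((c : GL n R) : Matrix n n R) * (((c : GL n R)⁻¹ : GL n R) : Matrix n n R) = 1 := by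
    rw [← Units.val_mul, mul_inv_cancel, Units.val_one]
  calc (g₂ : Matrix n n R) = (g₂ : Matrix n n R) * (((c : GL n R) : Matrix n n R) * (((c : GL n R)⁻¹ : GL n R) : Matrix n n R)) := by
        rw [hC, Matrix.mul_one]
    _ = (z • ((c : GL n R) : Matrix n n R)) * (((c : GL n R)⁻¹ : GL n R) : Matrix n n R) := by rw [← Matrix.mul_assoc, ← hmat]
    _ = z • (1 : Matrix n n R) := by rw [Matrix.smul_mul, hC]

variable {σ : R →+* R} {H₁ H₂ : Matrix n n R}

/-- **`γ₁ ↔ γ₂` with `γ₁ = z·1` forces `γ₂ = z·1`** (★ `Corresponds` is conjugacy in the ambient `GL_n(R)`). [cite: Rogawski1990, §14.1 p. 232] -/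
theorem Corresponds.val_eq_smul_one {γ₁ : unitaryGroup σ H₁} {γ₂ : unitaryGroup σ H₂} (h : Corresponds σ H₁ H₂ γ₁ γ₂) {z : R}
    (h₁ : ((γ₁ : GL n R) : Matrix n n R) = z • (1 : Matrix n n R)) : ((γ₂ : GL n R) : Matrix n n R) = z • (1 : Matrix n n R) :=
  val_eq_smul_one_of_isConj h h₁

/-- The same read from the right: `γ₁ ↔ γ₂` with `γ₂ = z·1` forces `γ₁ = z·1`. [cite: Rogawski1990, §14.1 p. 232] -/
theorem Corresponds.val_eq_smul_one_left {γ₁ : unitaryGroup σ H₁} {γ₂ : unitaryGroup σ H₂} (h : Corresponds σ H₁ H₂ γ₁ γ₂) {z : R}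
    (h₂ : ((γ₂ : GL n R) : Matrix n n R) = z • (1 : Matrix n n R)) : ((γ₁ : GL n R) : Matrix n n R) = z • (1 : Matrix n n R) :=
  val_eq_smul_one_of_isConj (corresponds_comm.1 h) h₂

/-- Elements of `U(H)(R)` are determined by their matrices. [folklore] -/
private theorem unitaryGroup_eq_of_val_eq {H : Matrix n n R} {γ δ : unitaryGroup σ H}
    (h : ((γ : GL n R) : Matrix n n R) = ((δ : GL n R) : Matrix n n R)) : γ = δ :=
  Subtype.ext (Units.ext h)

/-- **`γ₁ ↔ γ₂`, `γ₁ = z·1` and `δ = z·1` in `U(H₂)` give `γ₂ = δ`**: a corresponding element of a central (scalar) element IS the scalar element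
with the same entry. [cite: Rogawski1990, §14.1 p. 232] -/
theorem Corresponds.eq_of_val_eq_smul_one {γ₁ : unitaryGroup σ H₁} {γ₂ δ : unitaryGroup σ H₂} (h : Corresponds σ H₁ H₂ γ₁ γ₂) {z : R}
    (h₁ : ((γ₁ : GL n R) : Matrix n n R) = z • (1 : Matrix n n R)) (hδ : ((δ : GL n R) : Matrix n n R) = z • (1 : Matrix n n R)) :
    γ₂ = δ :=
  unitaryGroup_eq_of_val_eq ((h.val_eq_smul_one h₁).trans hδ.symm)

/-- The same read from the right: `γ₁ ↔ γ₂`, `γ₂ = z·1` and `δ = z·1` in `U(H₁)` give `γ₁ = δ`. [cite: Rogawski1990, §14.1 p. 232] -/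
theorem Corresponds.eq_of_val_eq_smul_one_left {γ₁ δ : unitaryGroup σ H₁} {γ₂ : unitaryGroup σ H₂} (h : Corresponds σ H₁ H₂ γ₁ γ₂) {z : R}
    (h₂ : ((γ₂ : GL n R) : Matrix n n R) = z • (1 : Matrix n n R)) (hδ : ((δ : GL n R) : Matrix n n R) = z • (1 : Matrix n n R)) :
    γ₁ = δ :=
  unitaryGroup_eq_of_val_eq ((h.val_eq_smul_one_left h₂).trans hδ.symm)

/-! ## §2 Class-preserving maps fix the centre -/

/-- **A class-preserving map `ψ : U(H₁) → U(H₂)` (`γ ↔ ψ γ` for all `γ`) sends `z·1` to `z·1`.** [cite: Rogawski1990, §14.1 p. 232] -/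
theorem apply_eq_of_forall_corresponds_of_val_eq_smul_one (ψ : unitaryGroup σ H₁ → unitaryGroup σ H₂)
    (hψ : ∀ γ, Corresponds σ H₁ H₂ γ (ψ γ)) {z : R} {γ : unitaryGroup σ H₁} {δ : unitaryGroup σ H₂}
    (hγ : ((γ : GL n R) : Matrix n n R) = z • (1 : Matrix n n R)) (hδ : ((δ : GL n R) : Matrix n n R) = z • (1 : Matrix n n R)) :
    ψ γ = δ :=
  (hψ γ).eq_of_val_eq_smul_one hγ hδ

/-- The same for a map class-preserving in the opposite reading (`ψ γ ↔ γ`, the shape of the engine line's pin (x) for `ψ_v⁻¹`).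
[cite: Rogawski1990, §14.1 p. 232] -/
theorem apply_eq_of_forall_corresponds_left_of_val_eq_smul_one (ψ : unitaryGroup σ H₂ → unitaryGroup σ H₁)
    (hψ : ∀ γ, Corresponds σ H₁ H₂ (ψ γ) γ) {z : R} {γ : unitaryGroup σ H₂} {δ : unitaryGroup σ H₁}
    (hγ : ((γ : GL n R) : Matrix n n R) = z • (1 : Matrix n n R)) (hδ : ((δ : GL n R) : Matrix n n R) = z • (1 : Matrix n n R)) :
    ψ γ = δ :=
  (hψ γ).eq_of_val_eq_smul_one_left hγ hδ

/-- **Matching test functions agree at the centre**: if `f₂ = f₁ ∘ ψ` for a class-preserving `ψ : U(H₂) → U(H₁)` (`ψ γ ↔ γ`), then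
`f₂ (z·1) = f₁ (z·1)` (the two scalars read in their respective groups). [cite: Rogawski1990, §14.5 p. 239] -/
theorem comp_apply_eq_of_forall_corresponds {X : Type*} (ψ : unitaryGroup σ H₂ → unitaryGroup σ H₁)
    (hψ : ∀ γ, Corresponds σ H₁ H₂ (ψ γ) γ) (f₁ : unitaryGroup σ H₁ → X) {f₂ : unitaryGroup σ H₂ → X} (hf : f₂ = f₁ ∘ ψ)
    {z : R} {γ : unitaryGroup σ H₂} {δ : unitaryGroup σ H₁}
    (hγ : ((γ : GL n R) : Matrix n n R) = z • (1 : Matrix n n R)) (hδ : ((δ : GL n R) : Matrix n n R) = z • (1 : Matrix n n R)) :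
    f₂ γ = f₁ δ := by
  rw [hf, Function.comp_apply, apply_eq_of_forall_corresponds_left_of_val_eq_smul_one ψ hψ hγ hδ]

end Algebra

/-! ## §3 The CM ∕ local dress (the engine line's pins (ix), (x)) -/

section CM

open NumberField IsDedekindDomain
open Literature.NumberTheory.Automorphic Literature.NumberTheory.Automorphic.UnitaryGroup

variable {L : Type} [Field L] [NumberField L] [IsCMField L] {N : ℕ} {H H' : Matrix (Fin N) (Fin N) L}
  {v : HeightOneSpectrum (𝓞 ↥(maximalRealSubfield L))}

/-- **`ψ_v⁻¹` fixes the centre**: for an identification `ψ : U(H)(L⁺_v) ≃ₜ* U(H′)(L⁺_v)` that is class-preserving in the reading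
`ψ⁻¹ γ ↔ γ` (the engine line's `IsPinned.corresponds_symm`), `ψ⁻¹` sends the element of `U(H′)(L⁺_v)` with matrix `z·1` to the element of
`U(H)(L⁺_v)` with matrix `z·1`. [cite: Rogawski1990, §14.1 p. 232] -/
theorem _root_.Literature.NumberTheory.Automorphic.UnitaryGroup.symm_apply_eq_of_central
    (ψ : (cmDatum L N H).Local v ≃ₜ* (cmDatum L N H').Local v)
    (hψ : ∀ γ : (cmDatum L N H').Local v,
      Corresponds (conjLocal L (IsCMField.complexConj L) v) ((adelicForm L N H).map (adeleToLocal L v))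
        ((adelicForm L N H').map (adeleToLocal L v)) (ψ.symm γ) γ)
    {z : LocalRing L v} {γ : (cmDatum L N H').Local v} {γ' : (cmDatum L N H).Local v}
    (hγ : ((γ.val : GL (Fin N) (LocalRing L v)) : Matrix (Fin N) (Fin N) (LocalRing L v)) = z • (1 : Matrix (Fin N) (Fin N) (LocalRing L v)))
    (hγ' : ((γ'.val : GL (Fin N) (LocalRing L v)) : Matrix (Fin N) (Fin N) (LocalRing L v)) = z • (1 : Matrix (Fin N) (Fin N) (LocalRing L v))) :
    ψ.symm γ = γ' :=
  apply_eq_of_forall_corresponds_left_of_val_eq_smul_one (fun g => ψ.symm g) hψ hγ hγ'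

/-- **N3-finite — matching local test functions agree at central elements: `f_v(ζ·1) = f′_v(ζ·1)`.**  For `ψ : U(H)(L⁺_v) ≃ₜ* U(H′)(L⁺_v)`
class-preserving (`ψ⁻¹ γ ↔ γ`, pin (x)) and local factors with `f = f′ ∘ ψ⁻¹` (pin (ix), (14.2.1) at a finite place), `f γ = f′ γ′` for the
central elements `γ ∈ U(H′)(L⁺_v)`, `γ′ ∈ U(H)(L⁺_v)` with the same scalar matrix `z·1` — the finite-place half of «`f′_v(γ₀) = f_v(γ₀)` for `γ₀`
central» in the proof of Thm. 14.5.1 (a). [cite: Rogawski1990, §14.5 p. 239] [cite: Rogawski1990, §14.2 pp. 232–233] -/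
theorem _root_.Literature.NumberTheory.Automorphic.UnitaryGroup.loc_apply_eq_of_eq_comp_symm_of_central {X : Type*}
    (ψ : (cmDatum L N H).Local v ≃ₜ* (cmDatum L N H').Local v)
    (hψ : ∀ γ : (cmDatum L N H').Local v,
      Corresponds (conjLocal L (IsCMField.complexConj L) v) ((adelicForm L N H).map (adeleToLocal L v))
        ((adelicForm L N H').map (adeleToLocal L v)) (ψ.symm γ) γ)
    (f' : (cmDatum L N H).Local v → X) {f : (cmDatum L N H').Local v → X} (hf : f = f' ∘ ψ.symm)
    {z : LocalRing L v} {γ : (cmDatum L N H').Local v} {γ' : (cmDatum L N H).Local v}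
    (hγ : ((γ.val : GL (Fin N) (LocalRing L v)) : Matrix (Fin N) (Fin N) (LocalRing L v)) = z • (1 : Matrix (Fin N) (Fin N) (LocalRing L v)))
    (hγ' : ((γ'.val : GL (Fin N) (LocalRing L v)) : Matrix (Fin N) (Fin N) (LocalRing L v)) = z • (1 : Matrix (Fin N) (Fin N) (LocalRing L v))) :
    f γ = f' γ' :=
  comp_apply_eq_of_forall_corresponds (fun g => ψ.symm g) hψ f' hf hγ hγ'

end CM

end Literature.NumberTheory.Rogawski1990

end
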